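import Summits.BirchSwinnertonDyer.BirchSwinnertonDyer.Theorems.SemiOrdinaryEisensteinDescentCasselsTateInnerTwist
import Summits.BirchSwinnertonDyer.BirchSwinnertonDyer.Theorems.SemiOrdinaryEisensteinDescentCasselsTateLocalTransport
import Literature.NumberTheory.EllipticCurves.SelmerGaloisActionPlaces
import Literature.NumberTheory.EllipticCurves.CasselsTateFiniteSupport
import Literature.NumberTheory.EllipticCurves.ArchimedeanKummerImageMaximal
import Literature.NumberTheory.GaloisRepresentations.ContinuousH2OrderTwo
import HarnessLib

/-!
# Transport of Milne's general-case Cassels–Tate data along an automorphism of the number field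

Route `SemiOrdinaryEisensteinDescent` (BSD, rung W-ALL row 2·3@3), Kolyvagin column, print item
`CasselsTateLevelInputsFact` (stmt-20191 ⊂ 25896 `KolyvaginPrimitivesAtThree`): towards conjunct (v) of
`Literature.NumberTheory.EllipticCurves.casselsTate_levelInputs` for THE canonical invariant maps.

`E = W/ℚ`, `K` a number field, `σ ∈ Aut(K/ℚ)` with a lift `τ` to `K̄`, `m` ODD, two alternating Weil-type
pairings `e`, `e₂` on `E[m²](K̄)` with `e₂(τ'S, τ'T) = τ'(e(S, T))` for every lift `τ'` of `σ`. For Milne's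
general-case data `D` (pairing `e`; *ADT* I, proof of Prop. 6.9) we construct (`exists_semilinearTransport`)
data `D₂` (pairing `e₂`) for the classes `σ_* b`, `σ_* b'` (`conjAct`) whose GLOBAL cochains are the
pull-backs `g ↦ τ · C(τ⁻¹ g τ)` of those of `D`, and prove

  `t_{σ v}(D₂) = t_v(D)` at every finite place `v`, `t_w(D₂) = t_w(D) = 0` at every infinite place `w`,

for THE invariant maps `LocalInvariants.canonical K (m·m)`. At `w = σ v` the restricted cochains of `D₂` are
the pull-backs, along the ADAPTED lift `τ_h = liftAutPlace σ h` and the Galois transport `K_v ≃ K_w`, of those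
of the INNER TWIST `δ ⋆ D`, `δ = τ_h⁻¹ τ ∈ Γ_K` (`exists_innerTwist`, p622333: same local terms as `D`); the
pulled-back local datum has the same term for THE maps (`term_canonical_of_semilinear`, `inv_w ∘ σ_* = inv_v`);
the local Kummer cocycle is irrelevant (`term_eq_of_kummer`). At the infinite places `H²(K_w, μ_{m²}) = 0`
(`m` odd). Also: `conjAct_mem_selmerGroup_of_odd` — `Sel^{(n)}(E/K)` is `Aut(K/ℚ)`-stable for odd `n` and
EVERY number field `K` (the tree's `conjAct_mem_selmerGroup` assumes `K` totally complex).

No named fact, no definition; BSD is not advanced.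

## References

* [MilneADT2006] J. S. Milne, *Arithmetic Duality Theorems*, 2nd ed. (2006), Ch. I §6, proof of Prop. 6.9,
  Rem. 3.7.
* [CasselsFrohlichANT1967] Cassels–Fröhlich (eds.), *Algebraic Number Theory* (1967), Ch. VI §1.1, VII §1.1.
* [GrossLMS1991] B. H. Gross, *Kolyvagin's work on modular elliptic curves* (1991), §5 (5.1).
-/

noncomputable section

open scoped Classical

-- the Theorems namespace of this sub repeats the summit name by design (D-0017 nested layout)
set_option linter.dupNamespace false
set_option autoImplicit false

namespace Summit.BirchSwinnertonDyer.BirchSwinnertonDyer.Theorems.CasselsTateConj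

open CategoryTheory _root_.WeierstrassCurve Field Function NumberField IsDedekindDomain
open Literature.NumberTheory.EllipticCurves Literature.NumberTheory.Automorphic
open Literature.NumberTheory.GaloisRepresentations Literature.NumberTheory.GaloisCohomology
open Literature.NumberTheory.GaloisRepresentations.DiscreteGaloisModule (mu MuCarrier pairing)
open scoped ContRepresentation

-- `K : Type`: the universe of `isConjCompatible_canonical` / `LocalInvariants.canonical`'s conj-compatibility
variable {K : Type} [Field K] [NumberField K] (W : WeierstrassCurve ℚ)

/-! ## Two lifts of `σ`: the cochain-level comparison -/

section Lifts

variable {σ : K ≃ₐ[ℚ] K} {τ₁ τ₂ : AlgebraicClosure K ≃+* AlgebraicClosure K}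

/-- `τ₁ P = τ₂ (δ P)` on `E[n]`, `δ = τ₂⁻¹ τ₁` (`IsLiftOfAut.torsionMap_eq_comp`, pointwise). [folklore] -/
theorem torsionMap_eq_torsionMap_divGal_smul (hτ₁ : IsLiftOfAut σ τ₁) (hτ₂ : IsLiftOfAut σ τ₂) (n : ℤ)
    (P : geomTorsion (W.baseChange K) n) :
    hτ₁.torsionMap W n P = hτ₂.torsionMap W n (hτ₁.divGal hτ₂ • P) := by
  rw [hτ₁.torsionMap_eq_comp W hτ₂ n]
  rfl

/-- `τ₁ ζ = τ₂ (δ ζ)` on `μ_N`, `δ = τ₂⁻¹ τ₁`. [folklore] -/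
theorem muSemilinearMap_eq_muSemilinearMap_divGal (hτ₁ : IsLiftOfAut σ τ₁) (hτ₂ : IsLiftOfAut σ τ₂) (N : ℕ)
    (ζ : MuCarrier K N) :
    muSemilinearMap τ₁ N ζ = muSemilinearMap τ₂ N (mu K N (hτ₁.divGal hτ₂) ζ) := by
  apply MuCarrier.eq_of_coe_eq
  rw [coe_muSemilinearMap, coe_muSemilinearMap, coe_mu_apply]
  change τ₁ _ = τ₂ ((show AlgebraicClosure K ≃ₐ[K] AlgebraicClosure K from hτ₁.divGal hτ₂) _)
  rw [IsLiftOfAut.divGal_apply, RingEquiv.apply_symm_apply]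

/-- `τ₁⁻¹ g τ₁ = δ⁻¹ (τ₂⁻¹ g τ₂) δ`, `δ = τ₂⁻¹ τ₁` (`IsLiftOfAut.conjGalCMH_eq_conj_comp`, pointwise). [folklore] -/
theorem conjGalCMH_eq_conj_divGal (hτ₁ : IsLiftOfAut σ τ₁) (hτ₂ : IsLiftOfAut σ τ₂)
    (g : absoluteGaloisGroup K) :
    hτ₁.conjGalCMH g = (hτ₁.divGal hτ₂)⁻¹ * hτ₂.conjGalCMH g * hτ₁.divGal hτ₂ := by
  rw [hτ₁.conjGalCMH_eq_conj_comp hτ₂]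
  rfl

end Lifts

/-! ## `Sel^{(n)}(E/K)` is `Aut(K/ℚ)`-stable for odd `n`, any number field `K` -/

/-- **`σ_* Sel^{(n)}(E/K) ⊆ Sel^{(n)}(E/K)` for odd `n` and EVERY number field `K`**: at the finite places the
Kummer conditions are permuted by `σ_*` (`conjActPlace_mem_kummerSelmerStructure`), and at the infinite places
`H¹(K_w, E[n]) = 0` for odd `n` (`galoisCohomology_one_torsion_eq_zero_infinitePlace_of_odd`). The tree's
`conjAct_mem_selmerGroup` is the same for `K` totally complex and every `n`. [cite: GrossLMS1991, §5 (5.1)]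
[cite: MilneADT2006, I Rem. 3.7] -/
theorem conjAct_mem_selmerGroup_of_odd (σ : K ≃ₐ[ℚ] K) {n : ℤ} (hn : Odd n)
    {s : galH1Torsion (W.baseChange K) n} (hs : s ∈ selmerGroup (W.baseChange K) n) :
    conjAct W σ n s ∈ selmerGroup (W.baseChange K) n := by
  rw [mem_selmerGroup_iff_forall_localization_mem] at hs ⊢
  rintro (w | w)
  · rw [galoisCohomology_one_torsion_eq_zero_infinitePlace_of_odd (W.baseChange K) w hn
      (galoisCohomology.localization ((W.baseChange K).torsionGaloisModule n) (Sum.inl w) 1 (conjAct W σ n s))]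
    exact zero_mem _
  · have h : σ • (σ⁻¹ • w) = w := smul_inv_smul σ w
    rw [← conjActPlace_localization W σ n h]
    exact conjActPlace_mem_kummerSelmerStructure W σ n h (hs _)

/-! ## The transport -/

section Transport

variable (m : ℕ) [NeZero m] (σ : K ≃ₐ[ℚ] K)
variable (e e₂ : geomTorsion (W.baseChange K) ((m * m : ℕ) : ℤ) → geomTorsion (W.baseChange K) ((m * m : ℕ) : ℤ) →
    AlgebraicClosure K)
  (hμ : ∀ S T, e S T ^ (m * m) = 1) (hμ₂ : ∀ S T, e₂ S T ^ (m * m) = 1)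
  (hadd₁ : ∀ S₁ S₂ T, e (S₁ + S₂) T = e S₁ T * e S₂ T) (hadd₁₂ : ∀ S₁ S₂ T, e₂ (S₁ + S₂) T = e₂ S₁ T * e₂ S₂ T)
  (hadd₂ : ∀ S T₁ T₂, e S (T₁ + T₂) = e S T₁ * e S T₂) (hadd₂₂ : ∀ S T₁ T₂, e₂ S (T₁ + T₂) = e₂ S T₁ * e₂ S T₂)
  (hgal : ∀ (g : absoluteGaloisGroup K) (S T : geomTorsion (W.baseChange K) ((m * m : ℕ) : ℤ)),
    g • e S T = e (g • S) (g • T))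
  (hgal₂ : ∀ (g : absoluteGaloisGroup K) (S T : geomTorsion (W.baseChange K) ((m * m : ℕ) : ℤ)),
    g • e₂ S T = e₂ (g • S) (g • T))

variable {W m σ e e₂ hμ hμ₂ hadd₁ hadd₁₂ hadd₂ hadd₂₂ hgal hgal₂}

/-- **The pulled-back data.** Let `m` be odd, `τ` a lift of `σ ∈ Aut(K/ℚ)`, and `e₂(τS, τT) = τ(e(S, T))`.
For Milne's data `D` (pairing `e`) there are data `D₂` (pairing `e₂`) for the classes `σ_* b`, `σ_* b'`
(`conjAct`; Selmer by `conjAct_mem_selmerGroup_of_odd`) whose global cochains `β₁, β', ε` (and `β, f`) are the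
pull-backs `g ↦ τ · C(τ⁻¹ g τ)` of those of `D`; the local Kummer cocycles are chosen by `exists_kummerLift`.
[cite: MilneADT2006, Ch. I §6, proof of Prop. 6.9] [cite: GrossLMS1991, §5 (5.1)] -/
theorem exists_pullbackData [W.IsElliptic] (hodd : Odd m) {τ : AlgebraicClosure K ≃+* AlgebraicClosure K}
    (hτ : IsLiftOfAut σ τ)
    (he : ∀ S T : geomTorsion (W.baseChange K) ((m * m : ℕ) : ℤ),
      e₂ (hτ.torsionMap W _ S) (hτ.torsionMap W _ T) = τ (e S T))
    (D : GeneralCaseData (W.baseChange K) m e hμ hadd₁ hadd₂ hgal) :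
    ∃ D₂ : GeneralCaseData (W.baseChange K) m e₂ hμ₂ hadd₁₂ hadd₂₂ hgal₂,
      D₂.b = conjAct W σ (m : ℤ) D.b ∧ D₂.b' = conjAct W σ (m : ℤ) D.b' ∧
      (∀ g, D₂.β₁ g = hτ.torsionMap W _ (D.β₁ (hτ.conjGalCMH g))) ∧
      (∀ g, D₂.β'.1 g = hτ.torsionMap W _ (D.β'.1 (hτ.conjGalCMH g))) ∧
      (∀ g h, D₂.ε (g, h) = muSemilinearMap τ (m * m) (D.ε (hτ.conjGalCMH g, hτ.conjGalCMH h))) := by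
  have hoddZ : Odd (m : ℤ) := (Int.odd_coe_nat m).mpr hodd
  -- the transported global cocycles and cochains
  let βτ : contOneCocycles ((W.baseChange K).torsionGaloisModule (m : ℤ)).toTopRep :=
    contOneCocycles.pullback hτ.conjGalCMH
      (semilinearHom hτ (hτ.torsionMap W (m : ℤ)) (hτ.torsionMap_smul W (m : ℤ))) D.β
  let β'τ : contOneCocycles ((W.baseChange K).torsionGaloisModule (m : ℤ)).toTopRep :=
    contOneCocycles.pullback hτ.conjGalCMH
      (semilinearHom hτ (hτ.torsionMap W (m : ℤ)) (hτ.torsionMap_smul W (m : ℤ))) D.β'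
  let fτ : contTwoCocycles ((W.baseChange K).torsionGaloisModule (m : ℤ)).toTopRep :=
    contTwoCocycles.pullback hτ.conjGalCMH
      (semilinearHom hτ (hτ.torsionMap W (m : ℤ)) (hτ.torsionMap_smul W (m : ℤ))) D.f
  let β₁τ : C(absoluteGaloisGroup K, geomTorsion (W.baseChange K) ((m * m : ℕ) : ℤ)) :=
    ⟨fun g => hτ.torsionMap W _ (D.β₁ (hτ.conjGalCMH g)),
      continuous_of_discreteTopology.comp (D.β₁.continuous.comp (map_continuous hτ.conjGalCMH))⟩
  let ετ : C(absoluteGaloisGroup K × absoluteGaloisGroup K, MuCarrier K (m * m)) :=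
    ⟨fun p => muSemilinearMap τ (m * m) (D.ε (hτ.conjGalCMH p.1, hτ.conjGalCMH p.2)),
      continuous_of_discreteTopology.comp (D.ε.continuous.comp
        (((map_continuous hτ.conjGalCMH).comp continuous_fst).prodMk
          ((map_continuous hτ.conjGalCMH).comp continuous_snd)))⟩
  have hβτ : oneCocycleClass _ βτ = conjAct W σ (m : ℤ) D.b := by
    rw [← D.hβ, ← hτ.conjH1_eq_conjAct, ← semilinearH_one_eq_conjH1]
    exact (map_oneCocycleClass _ _ _ _).symm
  have hβ'τ : oneCocycleClass _ β'τ = conjAct W σ (m : ℤ) D.b' := by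
    rw [← D.hβ', ← hτ.conjH1_eq_conjAct, ← semilinearH_one_eq_conjH1]
    exact (map_oneCocycleClass _ _ _ _).symm
  have hbτ : conjAct W σ (m : ℤ) D.b ∈ selmerGroup (W.baseChange K) (m : ℤ) :=
    conjAct_mem_selmerGroup_of_odd W σ hoddZ D.b_mem
  have hb'τ : conjAct W σ (m : ℤ) D.b' ∈ selmerGroup (W.baseChange K) (m : ℤ) :=
    conjAct_mem_selmerGroup_of_odd W σ hoddZ D.b'_mem
  -- local Kummer cocycles at every place, lifting `βτ` on the nose
  have hloc : ∀ v : Place K, locClass _ (Place.Completion v)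
      (resOne ((W.baseChange K).torsionGaloisModule (m : ℤ)) (Place.Completion v) βτ) ∈
        (W.baseChange K).kummerLocalConditionAt (m : ℤ) (Place.Completion v) := fun v => by
    rw [locClass_resOne, hβτ]
    exact ((W.baseChange K).mem_selmerGroup_iff_forall_localization_mem (m : ℤ) _).mp hbτ v
  choose κ hκmem hκ using fun v => exists_kummerLift (W.baseChange K) (Place.Completion v) m
    (resOne ((W.baseChange K).torsionGaloisModule (m : ℤ)) (Place.Completion v) βτ) (hloc v)
  let D₂ : GeneralCaseData (W.baseChange K) m e₂ hμ₂ hadd₁₂ hadd₂₂ hgal₂ :=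
    { b := conjAct W σ (m : ℤ) D.b
      b_mem := hbτ
      β := βτ
      hβ := hβτ
      β₁ := β₁τ
      mulK_β₁ := fun g => by
        change mulK (W.baseChange K) m m (hτ.torsionMap W _ (D.β₁ (hτ.conjGalCMH g))) =
          hτ.torsionMap W _ (D.β.1 (hτ.conjGalCMH g))
        rw [mulK_torsionMap, D.mulK_β₁]
      f := fτ
      inclKD_f := fun g h => by
        change inclKD (W.baseChange K) m m (hτ.torsionMap W _ (D.f.1 (hτ.conjGalCMH g, hτ.conjGalCMH h))) =
          g • hτ.torsionMap W _ (D.β₁ (hτ.conjGalCMH h)) - hτ.torsionMap W _ (D.β₁ (hτ.conjGalCMH (g * h))) +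
            hτ.torsionMap W _ (D.β₁ (hτ.conjGalCMH g))
        rw [inclKD_torsionMap, D.inclKD_f, map_add, map_sub, hτ.torsionMap_smul, _root_.map_mul hτ.conjGalCMH]
      b' := conjAct W σ (m : ℤ) D.b'
      b'_mem := hb'τ
      β' := β'τ
      hβ' := hβ'τ
      ε := ετ
      dTwo_ε := fun g h k => by
        have hd := D.dTwo_ε (hτ.conjGalCMH g) (hτ.conjGalCMH h) (hτ.conjGalCMH k)
        rw [ContPairing.cupCocycle₂₁_apply, dTwo_apply, descendPairing_toLin_apply] at hd
        rw [ContPairing.cupCocycle₂₁_apply, dTwo_apply, descendPairing_toLin_apply]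
        change descendHom (W.baseChange K) m m e₂ hμ₂ hadd₁₂ hadd₂₂
            (hτ.torsionMap W _ (D.f.1 (hτ.conjGalCMH g, hτ.conjGalCMH h)))
            (hτ.torsionMap W _ (D.β'.1 (hτ.conjGalCMH (g * h * k))) -
              hτ.torsionMap W _ (D.β'.1 (hτ.conjGalCMH (g * h)))) =
          (mu K (m * m)).toTopRep.ρ g (muSemilinearMap τ (m * m) (D.ε (hτ.conjGalCMH h, hτ.conjGalCMH k))) -
            muSemilinearMap τ (m * m) (D.ε (hτ.conjGalCMH (g * h), hτ.conjGalCMH k)) +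
            muSemilinearMap τ (m * m) (D.ε (hτ.conjGalCMH g, hτ.conjGalCMH (h * k))) -
            muSemilinearMap τ (m * m) (D.ε (hτ.conjGalCMH g, hτ.conjGalCMH h))
        rw [← map_sub, descendHom_torsionMap W m e e₂ hμ hμ₂ hadd₁ hadd₁₂ hadd₂ hadd₂₂ hτ he,
          _root_.map_mul hτ.conjGalCMH, _root_.map_mul hτ.conjGalCMH, _root_.map_mul hτ.conjGalCMH, hd, map_sub,
          map_add, map_sub]
        congr 3
        exact isSemilinear_mu hτ (m * m) g _
      κ := κ
      κ_mem := hκmem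
      mulK_κ := fun v g => by
        rw [hκ v g, resOne_apply]
        change hτ.torsionMap W _ (D.β.1 (hτ.conjGalCMH _)) =
          mulK (W.baseChange K) m m (hτ.torsionMap W _ (D.β₁ (hτ.conjGalCMH _)))
        rw [mulK_torsionMap, D.mulK_β₁] }
  exact ⟨D₂, rfl, rfl, fun g => rfl, fun g => rfl, fun g h => rfl⟩

/-- **At the infinite places the local term vanishes** for odd `m` and every family member
`inv_w = LocalInvariants.canonical K (m·m) (inl w)`: `H²(K_w, μ_{m²}) = 0` (`m²` odd, `Γ_{K_w}` of order `≤ 2`).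
[cite: MilneADT2006, I Rem. 3.7] -/
theorem localTerm_canonical_inl_eq_zero (hodd : Odd m) (D : GeneralCaseData (W.baseChange K) m e hμ hadd₁ hadd₂ hgal)
    (w : InfinitePlace K) : D.localTerm (LocalInvariants.canonical K (m * m)) (Sum.inl w) = 0 := by
  unfold GeneralCaseData.localTerm GeneralLocalData.term
  rw [galoisCohomology_two_toLocal_inl_eq_zero_of_odd (mu K (m * m)) w (hodd.mul hodd)
    (nsmul_muCarrier_eq_zero m) (locClass₂ _ _ (D.localData (Sum.inl w)).cocycle)]
  exact map_zero _

/-- **The local terms of pulled-back data at the finite places, for THE invariant maps.** Let `τ` lift `σ`,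
`e₂` alternating with `e₂(τ'S, τ'T) = τ'(e(S, T))` for every lift `τ'` of `σ`, and let `D₂` (pairing `e₂`) have
global cochains `β₁, β', ε` pulled back from those of `D` (pairing `e`) along `τ`. Then
`t_{σ v}(D₂) = t_v(D)` at every finite place `v` for `inv = LocalInvariants.canonical K (m·m)`: at `w = σ v` the
restricted cochains of `D₂` are the pull-backs, along the ADAPTED lift `τ_h = liftAutPlace σ h` and `K_v ≃ K_w`, of
those of the inner twist `δ ⋆ D`, `δ = τ_h⁻¹ τ` (`exists_innerTwist`: same local terms as `D`); the pulled-back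
local datum has the same term for THE maps (`term_canonical_of_semilinear`); the local Kummer cocycle of `D₂`
is irrelevant (`term_eq_of_kummer`). [cite: MilneADT2006, Ch. I §6, proof of Prop. 6.9]
[cite: CasselsFrohlichANT1967, Ch. VI §1.1 and Ch. VII §1.1] [cite: GrossLMS1991, §5 (5.1)] -/
theorem localTerm_canonical_inr_smul_eq [W.IsElliptic] {τ : AlgebraicClosure K ≃+* AlgebraicClosure K}
    (hτ : IsLiftOfAut σ τ) (halt₂ : ∀ T, e₂ T T = 1)
    (he : ∀ (τ' : AlgebraicClosure K ≃+* AlgebraicClosure K) (hτ' : IsLiftOfAut σ τ')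
      (S T : geomTorsion (W.baseChange K) ((m * m : ℕ) : ℤ)),
      e₂ (hτ'.torsionMap W _ S) (hτ'.torsionMap W _ T) = τ' (e S T))
    (D : GeneralCaseData (W.baseChange K) m e hμ hadd₁ hadd₂ hgal)
    (D₂ : GeneralCaseData (W.baseChange K) m e₂ hμ₂ hadd₁₂ hadd₂₂ hgal₂)
    (hβ₁ : ∀ g, D₂.β₁ g = hτ.torsionMap W _ (D.β₁ (hτ.conjGalCMH g)))
    (hβ' : ∀ g, D₂.β'.1 g = hτ.torsionMap W _ (D.β'.1 (hτ.conjGalCMH g)))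
    (hε : ∀ g h, D₂.ε (g, h) = muSemilinearMap τ (m * m) (D.ε (hτ.conjGalCMH g, hτ.conjGalCMH h)))
    (v : HeightOneSpectrum (𝓞 K)) :
    D₂.localTerm (LocalInvariants.canonical K (m * m)) (Sum.inr (σ • v)) =
      D.localTerm (LocalInvariants.canonical K (m * m)) (Sum.inr v) := by
  -- the finite places: `w = σ • v`, adapted lift `τ_h`, `δ = τ_h⁻¹ τ`
  have h : σ • v = σ • v := rfl
  haveI : CharZero (v.adicCompletion K) := charZero_of_injective_algebraMap (algebraMap K _).injective
  haveI : CharZero ((σ • v).adicCompletion K) := charZero_of_injective_algebraMap (algebraMap K _).injective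
  haveI : CharZero (Place.Completion (Sum.inr (σ • v) : Place K)) := charZero_placeCompletion _
  have hτh : IsLiftOfAut σ (liftAutPlace σ h) := isLiftOfAut_liftAutPlace σ h
  have hΘ := isLiftOfRingEquiv_ringEquivLift (galAdicCompletionEquiv (L := K) σ h)
  have hc : LiftsCommute (liftAutPlace σ h) (ringEquivLift (galAdicCompletionEquiv (L := K) σ h)) :=
    liftsCommute_liftAutPlace σ h
  -- the inner twist of `D` by `δ = τ_h⁻¹ τ` has the same local terms as `D`
  obtain ⟨D', -, -, -, hβ₁', -, hβ'', hε', -, hterm⟩ := exists_innerTwist D (hτ.divGal hτh)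
  -- the restricted cochains of `D₂` at `σ • v` are the pull-backs of those of `D'` at `v`
  have hkβ₁ : ∀ g, (D₂.localData (Sum.inr (σ • v) : Place K)).β₁ g =
      hτh.torsionMap W _ ((D'.localData (Sum.inr v : Place K)).β₁ (hΘ.conjGalCMH g)) := fun g => by
    change D₂.β₁ (absGaloisRestrict K ((σ • v).adicCompletion K) g) =
      hτh.torsionMap W _ (D'.β₁ (absGaloisRestrict K (v.adicCompletion K) (hΘ.conjGalCMH g)))
    rw [hβ₁, hc.absGaloisRestrict_conjGalCMH hτh hΘ, hβ₁', conjGalCMH_eq_conj_divGal hτ hτh,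
      torsionMap_eq_torsionMap_divGal_smul W hτ hτh]
  have hkβ' : ∀ g, (D₂.localData (Sum.inr (σ • v) : Place K)).β'.1 g =
      hτh.torsionMap W _ ((D'.localData (Sum.inr v : Place K)).β'.1 (hΘ.conjGalCMH g)) := fun g => by
    change D₂.β'.1 (absGaloisRestrict K ((σ • v).adicCompletion K) g) =
      hτh.torsionMap W _ (D'.β'.1 (absGaloisRestrict K (v.adicCompletion K) (hΘ.conjGalCMH g)))
    rw [hβ', hc.absGaloisRestrict_conjGalCMH hτh hΘ, hβ'', conjGalCMH_eq_conj_divGal hτ hτh,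
      torsionMap_eq_torsionMap_divGal_smul W hτ hτh]
  have hkε : ∀ g g', (D₂.localData (Sum.inr (σ • v) : Place K)).ε (g, g') =
      muSemilinearMap (liftAutPlace σ h) (m * m)
        ((D'.localData (Sum.inr v : Place K)).ε (hΘ.conjGalCMH g, hΘ.conjGalCMH g')) := fun g g' => by
    change D₂.ε (absGaloisRestrict K ((σ • v).adicCompletion K) g, absGaloisRestrict K ((σ • v).adicCompletion K) g') =
      muSemilinearMap (liftAutPlace σ h) (m * m) (D'.ε (absGaloisRestrict K (v.adicCompletion K) (hΘ.conjGalCMH g),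
        absGaloisRestrict K (v.adicCompletion K) (hΘ.conjGalCMH g')))
    rw [hε, hc.absGaloisRestrict_conjGalCMH hτh hΘ, hc.absGaloisRestrict_conjGalCMH hτh hΘ, hε',
      conjGalCMH_eq_conj_divGal hτ hτh, conjGalCMH_eq_conj_divGal hτ hτh]
    exact muSemilinearMap_eq_muSemilinearMap_divGal hτ hτh (m * m) _
  -- replace the local Kummer cocycle of `D₂` at `σ • v` by the pull-back of that of `D'` at `v`
  let κ₂ := contOneCocycles.pullback hΘ.conjGalCMH (localConjHom W hτh hΘ hc ((m * m : ℕ) : ℤ))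
    (D'.localData (Sum.inr v : Place K)).κ
  let L₂ : GeneralLocalData (W.baseChange K) m (Place.Completion (Sum.inr (σ • v) : Place K)) e₂ hμ₂ hadd₁₂
      hadd₂₂ hgal₂ :=
    { (D₂.localData (Sum.inr (σ • v) : Place K)) with
      κ := κ₂
      κ_mem := by
        rw [locClass_eq]
        change oneCocycleClass _ (contOneCocycles.pullback hΘ.conjGalCMH (localConjHom W hτh hΘ hc _)
          (D'.localData (Sum.inr v : Place K)).κ) ∈ _
        rw [← localConjH1_oneCocycleClass]
        exact localConjH1_mem_kummerLocalConditionAt W hτh hΘ hc _ (D'.localData (Sum.inr v : Place K)).κ_mem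
      mulK_κ := fun g => by
        rw [hkβ₁]
        change mulK (W.baseChange K) m m (hτh.torsionMap W _ ((D'.localData (Sum.inr v : Place K)).κ.1
            (hΘ.conjGalCMH g))) = _
        rw [mulK_torsionMap, mulK_torsionMap, (D'.localData (Sum.inr v : Place K)).mulK_κ] }
  calc D₂.localTerm (LocalInvariants.canonical K (m * m)) (Sum.inr (σ • v))
      = (D₂.localData (Sum.inr (σ • v) : Place K)).term (LocalInvariants.canonical K (m * m) (Sum.inr (σ • v))) :=
        rfl
    _ = L₂.term (LocalInvariants.canonical K (m * m) (Sum.inr (σ • v))) :=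
        GeneralLocalData.term_eq_of_kummer halt₂ _ rfl rfl rfl (D₂.locClass_β'_mem _)
    _ = (D'.localData (Sum.inr v : Place K)).term (LocalInvariants.canonical K (m * m) (Sum.inr v)) :=
        term_canonical_of_semilinear σ h (he _ hτh) hkβ₁ (fun g => rfl) hkβ' hkε
    _ = D.localTerm (LocalInvariants.canonical K (m * m)) (Sum.inr v) := hterm _ _


/-- **Transport of Milne's general-case data along `σ ∈ Aut(K/ℚ)`, with the local terms for THE invariant
maps** (assembly of `exists_pullbackData`, `localTerm_canonical_inr_smul_eq`, `localTerm_canonical_inl_eq_zero`):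
for `m` odd, `τ` a lift of `σ`, `e₂` alternating with `e₂(τ'S, τ'T) = τ'(e(S, T))` for every lift `τ'`, and data `D`
(pairing `e`), there are data `D₂` (pairing `e₂`) for `σ_* b`, `σ_* b'` with `t_{σ v}(D₂) = t_v(D)` at every finite
place and `t_w(D₂) = 0 = t_w(D)` at every infinite place, `inv = LocalInvariants.canonical K (m·m)`.
[cite: MilneADT2006, Ch. I §6, proof of Prop. 6.9] [cite: GrossLMS1991, §5 (5.1)] -/
theorem exists_semilinearTransport [W.IsElliptic] (hodd : Odd m) {τ : AlgebraicClosure K ≃+* AlgebraicClosure K}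
    (hτ : IsLiftOfAut σ τ) (halt₂ : ∀ T, e₂ T T = 1)
    (he : ∀ (τ' : AlgebraicClosure K ≃+* AlgebraicClosure K) (hτ' : IsLiftOfAut σ τ')
      (S T : geomTorsion (W.baseChange K) ((m * m : ℕ) : ℤ)),
      e₂ (hτ'.torsionMap W _ S) (hτ'.torsionMap W _ T) = τ' (e S T))
    (D : GeneralCaseData (W.baseChange K) m e hμ hadd₁ hadd₂ hgal) :
    ∃ D₂ : GeneralCaseData (W.baseChange K) m e₂ hμ₂ hadd₁₂ hadd₂₂ hgal₂,
      D₂.b = conjAct W σ (m : ℤ) D.b ∧ D₂.b' = conjAct W σ (m : ℤ) D.b' ∧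
      (∀ v : HeightOneSpectrum (𝓞 K),
        D₂.localTerm (LocalInvariants.canonical K (m * m)) (Sum.inr (σ • v)) =
          D.localTerm (LocalInvariants.canonical K (m * m)) (Sum.inr v)) ∧
      (∀ w : InfinitePlace K, D₂.localTerm (LocalInvariants.canonical K (m * m)) (Sum.inl w) = 0) ∧
      (∀ w : InfinitePlace K, D.localTerm (LocalInvariants.canonical K (m * m)) (Sum.inl w) = 0) := by
  obtain ⟨D₂, hb, hb', hβ₁, hβ', hε⟩ := exists_pullbackData (hμ₂ := hμ₂) (hadd₁₂ := hadd₁₂) (hadd₂₂ := hadd₂₂)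
    (hgal₂ := hgal₂) hodd hτ (he τ hτ) D
  exact ⟨D₂, hb, hb', localTerm_canonical_inr_smul_eq hτ halt₂ he D D₂ hβ₁ hβ' hε,
    localTerm_canonical_inl_eq_zero hodd D₂, localTerm_canonical_inl_eq_zero hodd D⟩

end Transport

end Summit.BirchSwinnertonDyer.BirchSwinnertonDyer.Theorems.CasselsTateConj

end
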